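import Mathlib
import Summits.Ventures.PercRepro2.CutSideEvents

/-!
# Row (LEAF-½) across a cut vertex, II: the `Q`-masses of the two halves in side probabilities
(blind cell PercRepro2, p5 g27; `proofs/P5-OEDGE.md` §35 addendum 1)

With `z` a cut vertex separating `{a₁, b}` from `{a₂, o, v}` (`CutSideEvents.lean`), every `Q`-mass
that enters `LeafHalfCross.groupL` and `groupH` is a product of side masses
(`mass_of_sides` = `prob_Qc_inter` behind an event identity proved at the membership level):
`P(Q) = 1 − P_A(a₁↔z)·P_B(a₂↔z)` (`mass_Q`), `P(Q, bL) = P_A(a₁↔b) − P_A(a₁↔b, a₁↔z)·P_B(a₂↔z)`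
(`mass_bL`), `P(Q, oH) = P_B(a₂↔o) − P_A(a₁↔z)·P_B(a₂↔o, a₂↔z)` (`mass_oH`), …,
`P(Q, oL) = P_A(a₁↔z)·[P_B(o↔z) − P_B(o↔z, a₂↔z)]` (`mass_oL`), and the mirror masses
`P(Q, bH) = [P_A(b↔z) − P_A(b↔z, a₁↔z)]·P_B(a₂↔z)` (`mass_bH`) with the four mixed masses that vanish
(`mass_zero`: an `A`-side event inside `{a₁ ↔ z}` together with a `B`-side event inside `{a₂ ↔ z}`
has no `Q`-mass).
-/

namespace Summit.Ventures.PercRepro2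

open UnionCluster CovForm PendantRoot LeafStep LeafHalfCross

namespace CutLeafRow

variable {V : Type*} {E : Type*} [Fintype E] [DecidableEq E] [Fintype V] [DecidableEq V]
  {R : Type*} [Field R] [LinearOrder R] [IsStrictOrderedRing R]

/-! ## The eleven `Q`-masses of `groupL` in side probabilities -/

section MassesL

variable (p : E → R) (ends : E → Sym2 V) {z : V} {VA VB : Set V} {EA EB : Set E}
  [DecidablePred (· ∈ EA)] [DecidablePred (· ∈ EB)]

omit [Fintype V] [DecidableEq V] [LinearOrder R] [IsStrictOrderedRing R] in
/-- `P(Q) = 1 − P_A(a₁ ↔ z)·P_B(a₂ ↔ z)`. -/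
lemma mass_Q (h : CutV.IsCut ends z VA VB EA EB) {a₁ a₂ : V} (ha₁ : a₁ ∈ VA) (ha₂ : a₂ ∈ VB) :
    prob p (avoidAll ends a₂ {a₁}) =
      1 - prob p (CutV.sideEvent EA (connEvent ends a₁ z)) *
        prob p (CutV.sideEvent EB (connEvent ends a₂ z)) := by
  rw [Q_eq h ha₁ ha₂, prob_compl, CutV.prob_sideEvent_inter_eq_mul p h]

omit [Fintype V] [DecidableEq V] [LinearOrder R] [IsStrictOrderedRing R] in
/-- The `Q`-mass of an event equal to `sA S ∩ sB U`. -/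
lemma mass_of_sides (h : CutV.IsCut ends z VA VB EA EB) {a₁ a₂ : V} (ha₁ : a₁ ∈ VA)
    (ha₂ : a₂ ∈ VB) {X : Set (Config E)} (S U : Set (Config E))
    (e : X = CutV.sideEvent EA S ∩ CutV.sideEvent EB U) :
    prob p (avoidAll ends a₂ {a₁} ∩ X) =
      prob p (CutV.sideEvent EA S) * prob p (CutV.sideEvent EB U) -
        prob p (CutV.sideEvent EA (S ∩ connEvent ends a₁ z)) *
          prob p (CutV.sideEvent EB (U ∩ connEvent ends a₂ z)) := by
  rw [e, Q_eq h ha₁ ha₂, prob_Qc_inter p h]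

omit [Fintype V] [DecidableEq V] [LinearOrder R] [IsStrictOrderedRing R] in
/-- `P(Q, bL) = P_A(a₁↔b) − P_A(a₁↔b, a₁↔z)·P_B(a₂↔z)`. -/
lemma mass_bL (h : CutV.IsCut ends z VA VB EA EB) {a₁ a₂ b : V} (ha₁ : a₁ ∈ VA) (hb : b ∈ VA)
    (ha₂ : a₂ ∈ VB) :
    prob p (avoidAll ends a₂ {a₁} ∩ connEvent ends a₁ b) =
      prob p (CutV.sideEvent EA (connEvent ends a₁ b)) -
        prob p (CutV.sideEvent EA (connEvent ends a₁ b ∩ connEvent ends a₁ z)) *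
          prob p (CutV.sideEvent EB (connEvent ends a₂ z)) := by
  have key := mass_of_sides p ends h ha₁ ha₂ (X := connEvent ends a₁ b) (connEvent ends a₁ b)
    Set.univ (by
    ext ω
    simp only [Set.mem_inter_iff, CutV.mem_sideEvent, Set.mem_univ, and_true]
    exact memA h ha₁ hb ω)
  rw [key, sideEvent_univ, prob_univ, mul_one, Set.univ_inter]

omit [Fintype V] [DecidableEq V] [LinearOrder R] [IsStrictOrderedRing R] in
/-- `P(Q, oH) = P_B(a₂↔o) − P_A(a₁↔z)·P_B(a₂↔o, a₂↔z)` (and the same for `v`). -/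
lemma mass_oH (h : CutV.IsCut ends z VA VB EA EB) {a₁ a₂ o : V} (ha₁ : a₁ ∈ VA) (ha₂ : a₂ ∈ VB)
    (ho : o ∈ VB) :
    prob p (avoidAll ends a₂ {a₁} ∩ connEvent ends a₂ o) =
      prob p (CutV.sideEvent EB (connEvent ends a₂ o)) -
        prob p (CutV.sideEvent EA (connEvent ends a₁ z)) *
          prob p (CutV.sideEvent EB (connEvent ends a₂ o ∩ connEvent ends a₂ z)) := by
  have key := mass_of_sides p ends h ha₁ ha₂ (X := connEvent ends a₂ o) Set.univ
    (connEvent ends a₂ o) (by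
    ext ω
    simp only [Set.mem_inter_iff, CutV.mem_sideEvent, Set.mem_univ, true_and]
    exact memB h ha₂ ho ω)
  rw [key, sideEvent_univ, prob_univ, one_mul, Set.univ_inter]

omit [Fintype V] [DecidableEq V] [LinearOrder R] [IsStrictOrderedRing R] in
/-- `P(Q, oH, bL)` (and the same for `v`). -/
lemma mass_oHbL (h : CutV.IsCut ends z VA VB EA EB) {a₁ a₂ b o : V} (ha₁ : a₁ ∈ VA)
    (hb : b ∈ VA) (ha₂ : a₂ ∈ VB) (ho : o ∈ VB) :
    prob p (avoidAll ends a₂ {a₁} ∩ (connEvent ends a₂ o ∩ connEvent ends a₁ b)) =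
      prob p (CutV.sideEvent EA (connEvent ends a₁ b)) *
          prob p (CutV.sideEvent EB (connEvent ends a₂ o)) -
        prob p (CutV.sideEvent EA (connEvent ends a₁ b ∩ connEvent ends a₁ z)) *
          prob p (CutV.sideEvent EB (connEvent ends a₂ o ∩ connEvent ends a₂ z)) :=
  mass_of_sides p ends h ha₁ ha₂ (X := connEvent ends a₂ o ∩ connEvent ends a₁ b)
    (connEvent ends a₁ b) (connEvent ends a₂ o) (by
    ext ω
    simp only [Set.mem_inter_iff, CutV.mem_sideEvent]
    rw [memB h ha₂ ho ω, memA h ha₁ hb ω]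
    tauto)

omit [Fintype V] [DecidableEq V] [LinearOrder R] [IsStrictOrderedRing R] in
/-- `P(Q, oL) = P_A(a₁↔z)·[P_B(o↔z) − P_B(o↔z, a₂↔z)]` (and the same for `v`). -/
lemma mass_oL (h : CutV.IsCut ends z VA VB EA EB) {a₁ a₂ o : V} (ha₁ : a₁ ∈ VA) (ha₂ : a₂ ∈ VB)
    (ho : o ∈ VB) :
    prob p (avoidAll ends a₂ {a₁} ∩ connEvent ends a₁ o) =
      prob p (CutV.sideEvent EA (connEvent ends a₁ z)) *
        (prob p (CutV.sideEvent EB (connEvent ends o z)) -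
          prob p (CutV.sideEvent EB (connEvent ends o z ∩ connEvent ends a₂ z))) := by
  have key := mass_of_sides p ends h ha₁ ha₂ (X := connEvent ends a₁ o) (connEvent ends a₁ z)
    (connEvent ends o z) (by
    ext ω
    simp only [Set.mem_inter_iff, CutV.mem_sideEvent]
    exact memAB h ha₁ ho ω)
  rw [key, Set.inter_self]
  ring

omit [Fintype V] [DecidableEq V] [LinearOrder R] [IsStrictOrderedRing R] in
/-- `P(Q, vH, oL, bL) = P_A(a₁↔b, a₁↔z)·[P_B(a₂↔v, o↔z) − P_B(a₂↔v, o↔z, a₂↔z)]`. -/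
lemma mass_vHoLbL (h : CutV.IsCut ends z VA VB EA EB) {a₁ a₂ b o v : V} (ha₁ : a₁ ∈ VA)
    (hb : b ∈ VA) (ha₂ : a₂ ∈ VB) (ho : o ∈ VB) (hv : v ∈ VB) :
    prob p (avoidAll ends a₂ {a₁} ∩
        (connEvent ends a₂ v ∩ (connEvent ends a₁ o ∩ connEvent ends a₁ b))) =
      prob p (CutV.sideEvent EA (connEvent ends a₁ b ∩ connEvent ends a₁ z)) *
        (prob p (CutV.sideEvent EB (connEvent ends a₂ v ∩ connEvent ends o z)) -
          prob p (CutV.sideEvent EB (connEvent ends a₂ v ∩ connEvent ends o z ∩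
            connEvent ends a₂ z))) := by
  have key := mass_of_sides p ends h ha₁ ha₂
    (X := connEvent ends a₂ v ∩ (connEvent ends a₁ o ∩ connEvent ends a₁ b))
    (connEvent ends a₁ b ∩ connEvent ends a₁ z) (connEvent ends a₂ v ∩ connEvent ends o z) (by
    ext ω
    simp only [Set.mem_inter_iff, CutV.mem_sideEvent]
    rw [memB h ha₂ hv ω, memAB h ha₁ ho ω, memA h ha₁ hb ω]
    tauto)
  have e2 : connEvent ends a₁ b ∩ connEvent ends a₁ z ∩ connEvent ends a₁ z =
      connEvent ends a₁ b ∩ connEvent ends a₁ z := by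
    rw [Set.inter_assoc, Set.inter_self]
  rw [key, e2]
  ring

omit [Fintype V] [DecidableEq V] [LinearOrder R] [IsStrictOrderedRing R] in
/-- `P(Q, vH, oH, bL)`. -/
lemma mass_vHoHbL (h : CutV.IsCut ends z VA VB EA EB) {a₁ a₂ b o v : V} (ha₁ : a₁ ∈ VA)
    (hb : b ∈ VA) (ha₂ : a₂ ∈ VB) (ho : o ∈ VB) (hv : v ∈ VB) :
    prob p (avoidAll ends a₂ {a₁} ∩
        (connEvent ends a₂ v ∩ (connEvent ends a₂ o ∩ connEvent ends a₁ b))) =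
      prob p (CutV.sideEvent EA (connEvent ends a₁ b)) *
          prob p (CutV.sideEvent EB (connEvent ends a₂ v ∩ connEvent ends a₂ o)) -
        prob p (CutV.sideEvent EA (connEvent ends a₁ b ∩ connEvent ends a₁ z)) *
          prob p (CutV.sideEvent EB (connEvent ends a₂ v ∩ connEvent ends a₂ o ∩
            connEvent ends a₂ z)) :=
  mass_of_sides p ends h ha₁ ha₂
    (X := connEvent ends a₂ v ∩ (connEvent ends a₂ o ∩ connEvent ends a₁ b)) (connEvent ends a₁ b)
    (connEvent ends a₂ v ∩ connEvent ends a₂ o) (by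
    ext ω
    simp only [Set.mem_inter_iff, CutV.mem_sideEvent]
    rw [memB h ha₂ hv ω, memB h ha₂ ho ω, memA h ha₁ hb ω]
    tauto)

omit [Fintype V] [DecidableEq V] [LinearOrder R] [IsStrictOrderedRing R] in
/-- `P(Q, vH, oL) = P_A(a₁↔z)·[P_B(a₂↔v, o↔z) − P_B(a₂↔v, o↔z, a₂↔z)]`. -/
lemma mass_vHoL (h : CutV.IsCut ends z VA VB EA EB) {a₁ a₂ o v : V} (ha₁ : a₁ ∈ VA)
    (ha₂ : a₂ ∈ VB) (ho : o ∈ VB) (hv : v ∈ VB) :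
    prob p (avoidAll ends a₂ {a₁} ∩ (connEvent ends a₂ v ∩ connEvent ends a₁ o)) =
      prob p (CutV.sideEvent EA (connEvent ends a₁ z)) *
        (prob p (CutV.sideEvent EB (connEvent ends a₂ v ∩ connEvent ends o z)) -
          prob p (CutV.sideEvent EB (connEvent ends a₂ v ∩ connEvent ends o z ∩
            connEvent ends a₂ z))) := by
  have key := mass_of_sides p ends h ha₁ ha₂ (X := connEvent ends a₂ v ∩ connEvent ends a₁ o)
    (connEvent ends a₁ z) (connEvent ends a₂ v ∩ connEvent ends o z) (by
    ext ω
    simp only [Set.mem_inter_iff, CutV.mem_sideEvent]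
    rw [memB h ha₂ hv ω, memAB h ha₁ ho ω]
    tauto)
  rw [key, Set.inter_self]
  ring

omit [Fintype V] [DecidableEq V] [LinearOrder R] [IsStrictOrderedRing R] in
/-- `P(Q, vH, oH)`. -/
lemma mass_vHoH (h : CutV.IsCut ends z VA VB EA EB) {a₁ a₂ o v : V} (ha₁ : a₁ ∈ VA)
    (ha₂ : a₂ ∈ VB) (ho : o ∈ VB) (hv : v ∈ VB) :
    prob p (avoidAll ends a₂ {a₁} ∩ (connEvent ends a₂ v ∩ connEvent ends a₂ o)) =
      prob p (CutV.sideEvent EB (connEvent ends a₂ v ∩ connEvent ends a₂ o)) -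
        prob p (CutV.sideEvent EA (connEvent ends a₁ z)) *
          prob p (CutV.sideEvent EB (connEvent ends a₂ v ∩ connEvent ends a₂ o ∩
            connEvent ends a₂ z)) := by
  have key := mass_of_sides p ends h ha₁ ha₂ (X := connEvent ends a₂ v ∩ connEvent ends a₂ o)
    Set.univ (connEvent ends a₂ v ∩ connEvent ends a₂ o) (by
    ext ω
    simp only [Set.mem_inter_iff, CutV.mem_sideEvent, Set.mem_univ, true_and]
    rw [memB h ha₂ hv ω, memB h ha₂ ho ω])
  rw [key, sideEvent_univ, prob_univ, one_mul, Set.univ_inter]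

end MassesL

/-! ## The masses of `groupH` -/

section MassesH

variable (p : E → R) (ends : E → Sym2 V) {z : V} {VA VB : Set V} {EA EB : Set E}
  [DecidablePred (· ∈ EA)] [DecidablePred (· ∈ EB)]

omit [Fintype V] [DecidableEq V] [LinearOrder R] [IsStrictOrderedRing R] in
/-- `P(Q, bH) = [P_A(b↔z) − P_A(b↔z, a₁↔z)]·P_B(a₂↔z)`. -/
lemma mass_bH (h : CutV.IsCut ends z VA VB EA EB) {a₁ a₂ b : V} (ha₁ : a₁ ∈ VA) (hb : b ∈ VA)
    (ha₂ : a₂ ∈ VB) :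
    prob p (avoidAll ends a₂ {a₁} ∩ connEvent ends a₂ b) =
      (prob p (CutV.sideEvent EA (connEvent ends b z)) -
        prob p (CutV.sideEvent EA (connEvent ends b z ∩ connEvent ends a₁ z))) *
        prob p (CutV.sideEvent EB (connEvent ends a₂ z)) := by
  have key := mass_of_sides p ends h ha₁ ha₂ (X := connEvent ends a₂ b) (connEvent ends b z)
    (connEvent ends a₂ z) (by
    ext ω
    simp only [Set.mem_inter_iff, CutV.mem_sideEvent]
    exact memBA h ha₂ hb ω)
  rw [key, Set.inter_self]
  ring

omit [Fintype V] [DecidableEq V] [LinearOrder R] [IsStrictOrderedRing R] in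
/-- An `A`-side event inside `{a₁ ↔ z}` together with a `B`-side event inside `{a₂ ↔ z}` has no
`Q`-mass. -/
lemma mass_zero (h : CutV.IsCut ends z VA VB EA EB) {a₁ a₂ : V} (ha₁ : a₁ ∈ VA) (ha₂ : a₂ ∈ VB)
    {X : Set (Config E)} (S U : Set (Config E))
    (e : X = CutV.sideEvent EA (S ∩ connEvent ends a₁ z) ∩
      CutV.sideEvent EB (U ∩ connEvent ends a₂ z)) :
    prob p (avoidAll ends a₂ {a₁} ∩ X) = 0 := by
  rw [mass_of_sides p ends h ha₁ ha₂ _ _ e, Set.inter_assoc, Set.inter_self, Set.inter_assoc,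
    Set.inter_self, sub_self]

omit [Fintype V] [DecidableEq V] [LinearOrder R] [IsStrictOrderedRing R] in
/-- `P(Q, oL, bH) = 0`. -/
lemma mass_oLbH (h : CutV.IsCut ends z VA VB EA EB) {a₁ a₂ b o : V} (ha₁ : a₁ ∈ VA)
    (hb : b ∈ VA) (ha₂ : a₂ ∈ VB) (ho : o ∈ VB) :
    prob p (avoidAll ends a₂ {a₁} ∩ (connEvent ends a₁ o ∩ connEvent ends a₂ b)) = 0 :=
  mass_zero p ends h ha₁ ha₂ (connEvent ends b z) (connEvent ends o z) (by
    ext ω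
    simp only [Set.mem_inter_iff, CutV.mem_sideEvent]
    rw [memAB h ha₁ ho ω, memBA h ha₂ hb ω]
    tauto)

omit [Fintype V] [DecidableEq V] [LinearOrder R] [IsStrictOrderedRing R] in
/-- `P(Q, vL, oL, bH) = 0`. -/
lemma mass_vLoLbH (h : CutV.IsCut ends z VA VB EA EB) {a₁ a₂ b o v : V} (ha₁ : a₁ ∈ VA)
    (hb : b ∈ VA) (ha₂ : a₂ ∈ VB) (ho : o ∈ VB) (hv : v ∈ VB) :
    prob p (avoidAll ends a₂ {a₁} ∩
      (connEvent ends a₁ v ∩ (connEvent ends a₁ o ∩ connEvent ends a₂ b))) = 0 :=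
  mass_zero p ends h ha₁ ha₂ (connEvent ends b z) (connEvent ends v z ∩ connEvent ends o z) (by
    ext ω
    simp only [Set.mem_inter_iff, CutV.mem_sideEvent]
    rw [memAB h ha₁ hv ω, memAB h ha₁ ho ω, memBA h ha₂ hb ω]
    tauto)

omit [Fintype V] [DecidableEq V] [LinearOrder R] [IsStrictOrderedRing R] in
/-- `P(Q, vL, oH, bH) = 0`. -/
lemma mass_vLoHbH (h : CutV.IsCut ends z VA VB EA EB) {a₁ a₂ b o v : V} (ha₁ : a₁ ∈ VA)
    (hb : b ∈ VA) (ha₂ : a₂ ∈ VB) (ho : o ∈ VB) (hv : v ∈ VB) :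
    prob p (avoidAll ends a₂ {a₁} ∩
      (connEvent ends a₁ v ∩ (connEvent ends a₂ o ∩ connEvent ends a₂ b))) = 0 :=
  mass_zero p ends h ha₁ ha₂ (connEvent ends b z) (connEvent ends v z ∩ connEvent ends a₂ o) (by
    ext ω
    simp only [Set.mem_inter_iff, CutV.mem_sideEvent]
    rw [memAB h ha₁ hv ω, memB h ha₂ ho ω, memBA h ha₂ hb ω]
    tauto)

omit [Fintype V] [DecidableEq V] [LinearOrder R] [IsStrictOrderedRing R] in
/-- `P(Q, vL, oL) = P_A(a₁↔z)·[P_B(v↔z, o↔z) − P_B(v↔z, o↔z, a₂↔z)]`. -/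
lemma mass_vLoL (h : CutV.IsCut ends z VA VB EA EB) {a₁ a₂ o v : V} (ha₁ : a₁ ∈ VA)
    (ha₂ : a₂ ∈ VB) (ho : o ∈ VB) (hv : v ∈ VB) :
    prob p (avoidAll ends a₂ {a₁} ∩ (connEvent ends a₁ v ∩ connEvent ends a₁ o)) =
      prob p (CutV.sideEvent EA (connEvent ends a₁ z)) *
        (prob p (CutV.sideEvent EB (connEvent ends v z ∩ connEvent ends o z)) -
          prob p (CutV.sideEvent EB (connEvent ends v z ∩ connEvent ends o z ∩
            connEvent ends a₂ z))) := by
  have key := mass_of_sides p ends h ha₁ ha₂ (X := connEvent ends a₁ v ∩ connEvent ends a₁ o)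
    (connEvent ends a₁ z) (connEvent ends v z ∩ connEvent ends o z) (by
    ext ω
    simp only [Set.mem_inter_iff, CutV.mem_sideEvent]
    rw [memAB h ha₁ hv ω, memAB h ha₁ ho ω]
    tauto)
  rw [key, Set.inter_self]
  ring

omit [Fintype V] [DecidableEq V] [LinearOrder R] [IsStrictOrderedRing R] in
/-- `P(Q, vL, oH) = P_A(a₁↔z)·[P_B(v↔z, a₂↔o) − P_B(v↔z, a₂↔o, a₂↔z)]`. -/
lemma mass_vLoH (h : CutV.IsCut ends z VA VB EA EB) {a₁ a₂ o v : V} (ha₁ : a₁ ∈ VA)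
    (ha₂ : a₂ ∈ VB) (ho : o ∈ VB) (hv : v ∈ VB) :
    prob p (avoidAll ends a₂ {a₁} ∩ (connEvent ends a₁ v ∩ connEvent ends a₂ o)) =
      prob p (CutV.sideEvent EA (connEvent ends a₁ z)) *
        (prob p (CutV.sideEvent EB (connEvent ends v z ∩ connEvent ends a₂ o)) -
          prob p (CutV.sideEvent EB (connEvent ends v z ∩ connEvent ends a₂ o ∩
            connEvent ends a₂ z))) := by
  have key := mass_of_sides p ends h ha₁ ha₂ (X := connEvent ends a₁ v ∩ connEvent ends a₂ o)
    (connEvent ends a₁ z) (connEvent ends v z ∩ connEvent ends a₂ o) (by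
    ext ω
    simp only [Set.mem_inter_iff, CutV.mem_sideEvent]
    rw [memAB h ha₁ hv ω, memB h ha₂ ho ω]
    tauto)
  rw [key, Set.inter_self]
  ring

end MassesH


end CutLeafRow

end Summit.Ventures.PercRepro2
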